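import Literature.AlgebraicGeometry.Motives.MixedHodgeStructureCatCompositionFactorsWeights
import Literature.AlgebraicGeometry.Motives.MixedHodgeStructureCatWeightsSumsHodgeClasses
import HarnessLib

/-!
# The associated weight-graded mixed Hodge structure `Gr^W_s X = ⨁_{j ∈ s} Gr^W_j X`: weights, graded pieces, length, composition factors, semisimplicity

Layer `Literature/AlgebraicGeometry/Motives` (lane `lit-hodgefound`), continuing the weight-truncation files of generation 44.  For a finite set
of integers `s` the functor **`grTotal s : MixedHodgeStructureCat ⥤ MixedHodgeStructureCat`, `X ↦ ⨁_{j ∈ s} (ofPure j)(Gr^W_j X)`** — the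
associated graded of the weight filtration, regarded again as a (split) mixed Hodge structure (Deligne's `Gr^W`, summed over the weights in
`s`).  When `s` contains the weights of `X` this object has the SAME weights, graded pieces, length and composition multiplicities as `X`
(g44-#8 `length_eq_sum_length_gr_of_subset`, g44-#9 `compMult_eq_sum_Ioc`), and it is SEMISIMPLE when `X` is graded-polarizable (each
polarizable pure piece is semisimple, `isSemisimpleObj_ofPure_obj_of_isPolarizable`) — whereas `X` itself need not be (extensions).
Unbundled, the tree uses the product MHS `MixedHodgeStructure.pi fun k : ↥s => (G.gr k).toMixedHodgeStructure` for the same purpose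
(`Motives/MixedHodgeStructureEndAlgPi`, `endAlg.grPiAlgEquiv`: its endomorphism algebra); here the object is the categorical biproduct, a functor
of `X`, with its inclusions ∕ projections `grTotalι`, `grTotalπ`.  As in
`Motives/MixedHodgeStructureCatSubobjects`, `HasFiniteBiproducts MixedHodgeStructureCat` (a theorem there, `hasFiniteBiproducts`; Mathlib keeps
it a non-instance) is carried as an instance hypothesis.

Sources, verbatim.  E. Cattani, F. El Zein, P. A. Griffiths, Lê D. T. (eds.), *Hodge Theory* (2014) [CattaniElZeinGriffithsLe2014] (held text
`book:cattani2014-hodge-theory-princeton-mathematical-notes-49`): Def. 3.2.15 (p0158; the graded pieces `Gr^W_n` carry pure HS of weight `n`),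
Cor. 3.2.21 (ii) (p0161 L14) «The functor `Gr^W_n` from the category of MHS to the category `A ⊗ ℚ` HS of weight `n` is exact», Ex. 3.2.23 (1)–(2)
(p0162–p0163: a HS of weight `n` is an MHS; direct sums).  C. Voisin, *Hodge Theory and Complex Algebraic Geometry I* [VoisinHodgeI2002], §7.3.1
Lemma 7.26 (polarized HS are semisimple; cited through the tree's `isSemisimpleObj_ofPure_obj_of_isPolarizable`).  H. Krause, *Homological Theory
of Representations* (2021) [Krause2021], Glossary «Grothendieck group» (held text p0026 L33 – p0027 L1) «the isomorphism classes of simple objects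
… form a basis (Jordan–Hölder theorem)».

## Main definitions and results (`s : Finset ℤ`, `[HasFiniteBiproducts MixedHodgeStructureCat]`)

* §1 **`grTotal s`** (+ `grTotal_obj`, `grTotal_map` by `rfl`), the inclusions ∕ projections `grTotalι s j : gr j ⋙ ofPure j ⟶ grTotal s`,
  `grTotalπ s j`, `grTotalι_comp_grTotalπ`; a private lemma `isIso_biproduct_π_of_isZero` (a biproduct with all but one summand zero).
* §2 weights: `isZero_ofPure_obj_iff`, `weightsIn_grTotal_obj` (weights `⊆ s ∩` weights of `X`), **`isWeight_grTotal_obj_iff`** (`↔ j ∈ s ∧ X` has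
  weight `j`), `setOf_isWeight_grTotal_obj`, `weightsIn_grTotal_obj_iff` (for `s ⊇` weights).
* §3 graded pieces: **`grGrTotalObjIso : (gr j)((grTotal s) X) ≅ (gr j) X` (`j ∈ s`)** (under `[∀ n, HasFiniteBiproducts (HodgeStructureCat n)]`,
  the tree's theorem `HodgeStructureCat.hasFiniteBiproducts`), `isZero_gr_obj_grTotal_obj` (`j ∉ s`),
  `isoGrTotalObjOfWeightsInSingleton` (`X` pure of weight `n ∈ s` ⟹ `(grTotal s) X ≅ X`).
* §4 invariants (`s ⊇` weights of `X`): **`length_grTotal_obj = length X`**, `compMult_eq_finsum_compMult_ofPure_gr`, `compMult_eq_sum_compMult_ofPure_gr_of_subset`,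
  **`compMult_grTotal_obj = compMult X`**.
* §5 **`isSemisimpleObj_grTotal_obj`** for graded-polarizable `X`.

Everything is PROVED; definitions with bodies; no named fact, no instance, no notation.

## References

* [CattaniElZeinGriffithsLe2014] E. Cattani et al. (eds.), Hodge Theory, Princeton Math. Notes 49 (2014), Def. 3.2.15, Cor. 3.2.21 (ii), Ex. 3.2.23.
* [VoisinHodgeI2002] C. Voisin, Hodge Theory and Complex Algebraic Geometry I (2002), §7.3.1, Lemma 7.26.
* [Krause2021] H. Krause, Homological Theory of Representations (2021), Glossary «Finite length», «Grothendieck group».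
* [DeligneHodgeII1971] P. Deligne, Théorie de Hodge II, Publ. Math. IHÉS 40 (1971), Déf. 2.3.1, Thm. 2.3.5.

## Provenance

Lane `lit-hodgefound` (summit `HodgeConjecture`), seat `lit-hodgefound-p36` (literature-prover, generation 44, row g44-#12).
-/

noncomputable section

open CategoryTheory CategoryTheory.Limits

namespace Literature.AlgebraicGeometry.Motives

open Literature.CategoryTheory.KrullSchmidt

universe u

namespace MixedHodgeStructureCat

section

variable [HasFiniteBiproducts MixedHodgeStructureCat.{u}] (s : Finset ℤ)

/-! ## §1 The associated weight-graded object -/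

/-- **The associated weight-graded mixed Hodge structure over `s`: `X ↦ ⨁_{j ∈ s} (ofPure j)(Gr^W_j X)`**, a functor.
[cite: CattaniElZeinGriffithsLe2014, Def. 3.2.15 and Ex. 3.2.23 (1)–(2)] [cite: DeligneHodgeII1971, Déf. 2.3.1] -/
def grTotal : MixedHodgeStructureCat.{u} ⥤ MixedHodgeStructureCat.{u} where
  obj X := ⨁ fun j : s => (ofPure (j : ℤ)).obj ((gr (j : ℤ)).obj X)
  map f := biproduct.map fun j : s => (ofPure (j : ℤ)).map ((gr (j : ℤ)).map f)
  map_id X := by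
    ext j
    simp
  map_comp f g := by
    ext j
    simp

/-- `(grTotal s) X = ⨁_{j ∈ s} (ofPure j)(Gr^W_j X)` (by `rfl`). [cite: CattaniElZeinGriffithsLe2014, Def. 3.2.15] -/
theorem grTotal_obj (X : MixedHodgeStructureCat.{u}) : (grTotal s).obj X = ⨁ fun j : s => (ofPure (j : ℤ)).obj ((gr (j : ℤ)).obj X) := rfl

/-- `(grTotal s) f = ⨁_j (ofPure j)(Gr^W_j f)` (by `rfl`). [cite: CattaniElZeinGriffithsLe2014, Cor. 3.2.21 (ii)] -/
theorem grTotal_map {X Y : MixedHodgeStructureCat.{u}} (f : X ⟶ Y) :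
    (grTotal s).map f = biproduct.map fun j : s => (ofPure (j : ℤ)).map ((gr (j : ℤ)).map f) := rfl

/-- The inclusion of the `j`-th graded piece `(ofPure j)(Gr^W_j X) ⟶ (grTotal s) X`, natural in `X`. [cite: CattaniElZeinGriffithsLe2014, Ex. 3.2.23 (2)] -/
def grTotalι (j : s) : gr.{u} (j : ℤ) ⋙ ofPure (j : ℤ) ⟶ grTotal s where
  app X := biproduct.ι (fun i : s => (ofPure (i : ℤ)).obj ((gr (i : ℤ)).obj X)) j
  naturality _ _ f := (biproduct.ι_map (fun i : s => (ofPure (i : ℤ)).map ((gr (i : ℤ)).map f)) j).symm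

/-- The projection onto the `j`-th graded piece `(grTotal s) X ⟶ (ofPure j)(Gr^W_j X)`, natural in `X`. [cite: CattaniElZeinGriffithsLe2014, Ex. 3.2.23 (2)] -/
def grTotalπ (j : s) : grTotal.{u} s ⟶ gr (j : ℤ) ⋙ ofPure (j : ℤ) where
  app X := biproduct.π (fun i : s => (ofPure (i : ℤ)).obj ((gr (i : ℤ)).obj X)) j
  naturality _ _ f := biproduct.map_π (fun i : s => (ofPure (i : ℤ)).map ((gr (i : ℤ)).map f)) j

/-- `ι_j ≫ π_j = 𝟙`. [cite: CattaniElZeinGriffithsLe2014, Ex. 3.2.23 (2)] -/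
theorem grTotalι_comp_grTotalπ (j : s) : grTotalι.{u} s j ≫ grTotalπ s j = 𝟙 _ :=
  NatTrans.ext (funext fun X => biproduct.ι_π_self (fun i : s => (ofPure (i : ℤ)).obj ((gr (i : ℤ)).obj X)) j)

omit [HasFiniteBiproducts MixedHodgeStructureCat.{u}] s in
/-- In a biproduct whose summands other than the `k`-th are zero, the `k`-th projection is an isomorphism (inverse the `k`-th inclusion). [folklore] -/
private theorem isIso_biproduct_π_of_isZero {C : Type*} [Category C] [Preadditive C] {J : Type} [Fintype J] (G : J → C) [HasBiproduct G]
    (k : J) (h : ∀ j, j ≠ k → IsZero (G j)) : IsIso (biproduct.π G k) :=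
  ⟨⟨biproduct.ι G k, by
    rw [← biproduct.total, Finset.sum_eq_single_of_mem k (Finset.mem_univ k) fun j _ hj => by
      rw [(h j hj).eq_of_tgt (biproduct.π G j) 0, zero_comp]], biproduct.ι_π_self G k⟩⟩

/-! ## §2 Weights of `(grTotal s) X` -/

omit [HasFiniteBiproducts MixedHodgeStructureCat.{u}] s in
/-- `(ofPure n) Y = 0` iff `Y = 0`. [cite: CattaniElZeinGriffithsLe2014, Ex. 3.2.23 (1)] -/
theorem isZero_ofPure_obj_iff {n : ℤ} (Y : HodgeStructureCat.{u} n) : IsZero ((ofPure n).obj Y) ↔ IsZero Y := by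
  rw [isZero_iff_subsingleton, HodgeStructureCat.isZero_iff_subsingleton]
  exact Iff.rfl

/-- **The weights of `(grTotal s) X` are among `s ∩` (weights of `X`).** [cite: CattaniElZeinGriffithsLe2014, Def. 3.2.15 and Ex. 3.2.23 (1)–(2)] -/
theorem weightsIn_grTotal_obj (X : MixedHodgeStructureCat.{u}) : weightsIn (↑s ∩ {j | X.str.IsWeight j}) ((grTotal s).obj X) := by
  refine prop_weightsIn_of_iso (biproduct.isoProduct _).symm (weightsIn_piObj fun j => ?_)
  by_cases hj : X.str.IsWeight (j : ℤ)
  · exact weightsIn_of_subset (Set.singleton_subset_iff.2 (Set.mem_inter (Finset.mem_coe.2 j.2) hj)) (weightsIn_ofPure_gr_obj (j : ℤ) X)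
  · exact prop_weightsIn_of_isZero ((ofPure (j : ℤ)).map_isZero ((isZero_gr_obj_iff_not_isWeight _ X).2 hj)) _

/-- **`(grTotal s) X` has weight `j` iff `j ∈ s` and `X` has weight `j`.** [cite: CattaniElZeinGriffithsLe2014, Def. 3.2.15 and Ex. 3.2.23 (1)–(2)] -/
theorem isWeight_grTotal_obj_iff (X : MixedHodgeStructureCat.{u}) (j : ℤ) : ((grTotal s).obj X).str.IsWeight j ↔ j ∈ s ∧ X.str.IsWeight j := by
  refine ⟨fun h => (weightsIn_grTotal_obj s X) h, fun h => ?_⟩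
  obtain ⟨hjs, hj⟩ := h
  -- the `j`-th summand is a non-zero pure MHS of weight `j`, and a subobject of `(grTotal s) X`
  haveI : Nontrivial ((ofPure j).obj ((gr j).obj X)) := not_subsingleton_iff_nontrivial.1 fun hs' =>
    (isZero_gr_obj_iff_not_isWeight j X).1 ((isZero_ofPure_obj_iff _).1 ((isZero_iff_subsingleton _).2 hs')) hj
  have hw : ((ofPure j).obj ((gr j).obj X)).str.IsWeight j := (isPure_ofPure_obj ((gr j).obj X)).isWeight
  by_contra hnot
  have hc : weightsIn ({j}ᶜ : Set ℤ) ((grTotal s).obj X) := fun k hk => fun hkj => hnot (by rw [Set.mem_singleton_iff.1 hkj] at hk; exact hk)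
  exact prop_weightsIn_of_mono (biproduct.ι (fun i : s => (ofPure (i : ℤ)).obj ((gr (i : ℤ)).obj X)) ⟨j, hjs⟩) hc hw rfl

/-- The set of weights of `(grTotal s) X` is `s ∩` (weights of `X`). [cite: CattaniElZeinGriffithsLe2014, Def. 3.2.15] -/
theorem setOf_isWeight_grTotal_obj (X : MixedHodgeStructureCat.{u}) :
    {j | ((grTotal s).obj X).str.IsWeight j} = ↑s ∩ {j | X.str.IsWeight j} :=
  Set.ext fun j => isWeight_grTotal_obj_iff s X j

/-- For `s ⊇` (weights of `X`), `(grTotal s) X` and `X` have the same weights: `weightsIn S ((grTotal s) X) ↔ weightsIn S X`.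
[cite: CattaniElZeinGriffithsLe2014, Def. 3.2.15] -/
theorem weightsIn_grTotal_obj_iff {S : Set ℤ} {X : MixedHodgeStructureCat.{u}} (hs : ∀ ⦃j⦄, X.str.IsWeight j → j ∈ s) :
    weightsIn S ((grTotal s).obj X) ↔ weightsIn S X :=
  ⟨fun h _ hj => h ((isWeight_grTotal_obj_iff s X _).2 ⟨hs hj, hj⟩), fun h _ hj => h ((isWeight_grTotal_obj_iff s X _).1 hj).2⟩

/-! ## §3 Graded pieces of `(grTotal s) X` -/

variable [∀ n : ℤ, HasFiniteBiproducts (HodgeStructureCat.{u} n)]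

/-- **`Gr^W_j((grTotal s) X) ≅ Gr^W_j X` for `j ∈ s`**: `Gr^W_j` commutes with the biproduct, kills the summands of weight `≠ j`, and
`Gr^W_j((ofPure j) Y) ≅ Y`. [cite: CattaniElZeinGriffithsLe2014, Cor. 3.2.21 (ii) and Ex. 3.2.23 (1)] -/
def grGrTotalObjIso (j : s) (X : MixedHodgeStructureCat.{u}) : (gr (j : ℤ)).obj ((grTotal s).obj X) ≅ (gr (j : ℤ)).obj X :=
  (gr (j : ℤ)).mapBiproduct (fun i : s => (ofPure (i : ℤ)).obj ((gr (i : ℤ)).obj X)) ≪≫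
    @asIso _ _ _ _ (biproduct.π (fun i : s => (gr (j : ℤ)).obj ((ofPure (i : ℤ)).obj ((gr (i : ℤ)).obj X))) j)
      (isIso_biproduct_π_of_isZero _ j fun i hi =>
        isZero_gr_obj_ofPure_obj (fun h => hi (Subtype.ext (by exact_mod_cast h.symm))) _) ≪≫
    (ofPureCompGrIso (j : ℤ)).app ((gr (j : ℤ)).obj X)

omit [∀ n : ℤ, HasFiniteBiproducts (HodgeStructureCat.{u} n)] in
/-- `Gr^W_j((grTotal s) X) = 0` for `j ∉ s`. [cite: CattaniElZeinGriffithsLe2014, Def. 3.2.15] -/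
theorem isZero_gr_obj_grTotal_obj {j : ℤ} (hj : j ∉ s) (X : MixedHodgeStructureCat.{u}) : IsZero ((gr j).obj ((grTotal s).obj X)) :=
  (isZero_gr_obj_iff_not_isWeight j _).2 fun h => hj ((isWeight_grTotal_obj_iff s X j).1 h).1

omit [∀ n : ℤ, HasFiniteBiproducts (HodgeStructureCat.{u} n)] in
/-- **A pure `X` of weight `n ∈ s` is its own associated graded: `(grTotal s) X ≅ X`** (the summands of weight `≠ n` vanish, and
`(ofPure n)(Gr^W_n X) ≅ X`). [cite: CattaniElZeinGriffithsLe2014, Def. 3.2.15 and Ex. 3.2.23 (1)] -/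
def isoGrTotalObjOfWeightsInSingleton {n : ℤ} (hn : n ∈ s) {X : MixedHodgeStructureCat.{u}} (hX : weightsIn {n} X) : (grTotal s).obj X ≅ X :=
  @asIso _ _ _ _ (biproduct.π (fun i : s => (ofPure (i : ℤ)).obj ((gr (i : ℤ)).obj X)) ⟨n, hn⟩)
      (isIso_biproduct_π_of_isZero _ _ fun i hi => (ofPure (i : ℤ)).map_isZero ((isZero_gr_obj_iff_not_isWeight (i : ℤ) X).2 fun hw =>
        hi (Subtype.ext (Set.mem_singleton_iff.1 (hX hw))))) ≪≫
    (isoOfPureGrOfWeightsInSingleton hX).symm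

/-! ## §4 Numerical invariants: length and composition multiplicities -/

omit [∀ n : ℤ, HasFiniteBiproducts (HodgeStructureCat.{u} n)] in
/-- **`ℓ((grTotal s) X) = ℓ(X)`** when `s` contains the weights of `X`. [cite: Krause2021, Glossary «Finite length» (PDF p. 21)]
[cite: CattaniElZeinGriffithsLe2014, Def. 3.2.15 and Cor. 3.2.21 (ii)] -/
theorem length_grTotal_obj {X : MixedHodgeStructureCat.{u}} (hs : ∀ ⦃j⦄, X.str.IsWeight j → j ∈ s) : length ((grTotal s).obj X) = length X := by
  rw [grTotal_obj, length_biproduct', length_eq_sum_length_gr_of_subset hs, ← Finset.sum_coe_sort s fun j => length ((gr j).obj X)]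
  exact Finset.sum_congr rfl fun j _ => length_ofPure_obj _

omit [HasFiniteBiproducts MixedHodgeStructureCat.{u}] [∀ n : ℤ, HasFiniteBiproducts (HodgeStructureCat.{u} n)] s in
/-- `[X : T] = Σ_j [(ofPure j)(Gr^W_j X) : T]`, the sum over all `j` (finite support). [cite: Krause2021, Glossary «Grothendieck group»]
[cite: CattaniElZeinGriffithsLe2014, Def. 3.2.15 and Cor. 3.2.21 (ii)] -/
theorem compMult_eq_finsum_compMult_ofPure_gr (X : MixedHodgeStructureCat.{u}) [IsArtinianObject X] [IsNoetherianObject X] (T : MixedHodgeStructureCat.{u}) :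
    compMult X T = ∑ᶠ j, compMult ((ofPure j).obj ((gr j).obj X)) T := by
  obtain ⟨a, ha⟩ := X.str.exists_W_eq_bot
  obtain ⟨b, hb⟩ := X.str.exists_W_eq_top
  rw [compMult_eq_sum_Ioc X ha hb T, eq_comm]
  refine finsum_eq_sum_of_support_subset _ fun j hj => setOf_isWeight_subset_Ioc ha hb ?_
  by_contra hw
  exact hj (compMult_of_isZero ((ofPure j).map_isZero ((isZero_gr_obj_iff_not_isWeight j X).2 hw)) T)

omit [HasFiniteBiproducts MixedHodgeStructureCat.{u}] [∀ n : ℤ, HasFiniteBiproducts (HodgeStructureCat.{u} n)] in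
/-- `[X : T] = Σ_{j ∈ s} [(ofPure j)(Gr^W_j X) : T]` for every finite `s` containing the weights of `X`. [cite: Krause2021, Glossary «Grothendieck group»]
[cite: CattaniElZeinGriffithsLe2014, Def. 3.2.15 and Cor. 3.2.21 (ii)] -/
theorem compMult_eq_sum_compMult_ofPure_gr_of_subset {X : MixedHodgeStructureCat.{u}} [IsArtinianObject X] [IsNoetherianObject X]
    (hs : ∀ ⦃j⦄, X.str.IsWeight j → j ∈ s) (T : MixedHodgeStructureCat.{u}) :
    compMult X T = ∑ j ∈ s, compMult ((ofPure j).obj ((gr j).obj X)) T := by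
  rw [compMult_eq_finsum_compMult_ofPure_gr X T]
  refine finsum_eq_sum_of_support_subset _ fun j hj => Finset.mem_coe.2 (hs ?_)
  by_contra hw
  exact hj (compMult_of_isZero ((ofPure j).map_isZero ((isZero_gr_obj_iff_not_isWeight j X).2 hw)) T)

omit [∀ n : ℤ, HasFiniteBiproducts (HodgeStructureCat.{u} n)] in
/-- **`[(grTotal s) X : T] = [X : T]`** for `X` of finite length and `s ⊇` (weights of `X`): `X` and its associated weight-graded object have the
same composition factors. [cite: Krause2021, Glossary «Grothendieck group»] [cite: CattaniElZeinGriffithsLe2014, Def. 3.2.15 and Cor. 3.2.21 (ii)] -/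
theorem compMult_grTotal_obj {X : MixedHodgeStructureCat.{u}} [IsArtinianObject X] [IsNoetherianObject X] (hs : ∀ ⦃j⦄, X.str.IsWeight j → j ∈ s)
    (T : MixedHodgeStructureCat.{u}) : compMult ((grTotal s).obj X) T = compMult X T := by
  set S : s → MixedHodgeStructureCat.{u} := fun j => (ofPure (j : ℤ)).obj ((gr (j : ℤ)).obj X)
  set e := (Fintype.equivFin (↥s)).symm
  have w : (grTotal s).obj X ≅ ⨁ fun i : Fin (Fintype.card (↥s)) => S (e i) :=
    (biproduct.whiskerEquiv (f := fun i : Fin (Fintype.card (↥s)) => S (e i)) (g := S) e fun _ => Iso.refl _).symm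
  rw [compMult_congr_left w T,
    compMult_biproduct T _ (fun i => isArtinianObject_ofPure_gr_obj _ X) (fun i => isNoetherianObject_ofPure_gr_obj _ X),
    e.sum_comp (fun j => compMult (S j) T), Finset.sum_coe_sort s (fun j => compMult ((ofPure j).obj ((gr j).obj X)) T),
    compMult_eq_sum_compMult_ofPure_gr_of_subset s hs T]

/-! ## §5 Semisimplicity -/

omit [∀ n : ℤ, HasFiniteBiproducts (HodgeStructureCat.{u} n)] in
/-- **The associated weight-graded object of a graded-polarizable MHS is semisimple** (each polarizable pure piece is a semisimple object,
and semisimplicity is stable under finite biproducts) — although `X` itself need not be. [cite: VoisinHodgeI2002, §7.3.1 Lemma 7.26]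
[cite: CattaniElZeinGriffithsLe2014, Def. 3.2.15 and Ex. 3.2.23 (1)–(2)] -/
theorem isSemisimpleObj_grTotal_obj {X : MixedHodgeStructureCat.{u}} (hX : isGradedPolarizable X) : IsSemisimpleObj ((grTotal s).obj X) := by
  set S : s → MixedHodgeStructureCat.{u} := fun j => (ofPure (j : ℤ)).obj ((gr (j : ℤ)).obj X)
  set e := (Fintype.equivFin (↥s)).symm
  have w : (grTotal s).obj X ≅ ⨁ fun i : Fin (Fintype.card (↥s)) => S (e i) :=
    (biproduct.whiskerEquiv (f := fun i : Fin (Fintype.card (↥s)) => S (e i)) (g := S) e fun _ => Iso.refl _).symm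
  haveI := hX.finite
  have hS : ∀ j : s, IsSemisimpleObj (S j) := fun j =>
    haveI : Module.Finite ℚ ((gr (j : ℤ)).obj X) := inferInstanceAs (Module.Finite ℚ (MixedHodgeStructure.grW X.str.W (j : ℤ)))
    isSemisimpleObj_ofPure_obj_of_isPolarizable ((gr (j : ℤ)).obj X) (hX.2 (j : ℤ))
  exact (isSemisimpleObj_biproduct _ fun i => hS (e i)).of_iso w

end

end MixedHodgeStructureCat

end Literature.AlgebraicGeometry.Motives

end
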